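import Summits.KontsevichZagierPeriods.KontsevichZagierPeriods.Theorems.RootDecompZetaThreeFrontierWordMatchPreludeP12

/-! # `RootDecompZetaThreeFrontierWordMatchPreludeP13` — part 5/6 of the mechanical ≤340-line split of `src.lean`
(split by the decomp-kz census seat for landing; mathematics unchanged; part 5 continues part 4). -/

set_option linter.dupNamespace false

noncomputable section

namespace Summit.KontsevichZagierPeriods.KontsevichZagierPeriods.Cruxes.GZNormalFormWThree.GZLadder
open Set MeasureTheory Literature.NumberTheory.Transcendental
open Summit.KontsevichZagierPeriods.RootDecompZetaThreeFrontier

/-- **D6' step in gap coordinates** (`α ↓`, `β₀ ↑`). -/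
theorem lowerT0G (H Qg : MvPolynomial (Fin 4) ℚ) (g β₁ γ₁ γ₂ a : ℕ) (ha : 1 ≤ a)
    (hRint : IntegrableOn (WordLayer.layerF (WordLayer.toT (WordLayer.gR0Q H Qg g a)) (g + 1) β₁ γ₁ γ₂ a) (KZ.openOrderedSimplex 3))
    (hR : ∀ s : KZ.IntegralRep 3, s.domain = simplex 3 →
      EqOn s.integrand (WordLayer.layerF (WordLayer.toT (WordLayer.gR0Q H Qg g a)) (g + 1) β₁ γ₁ γ₂ a) s.domain → CongInto (layerThree ∪ gzLETwo) (KZ.of s))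
    (r : KZ.IntegralRep 3) (hd : r.domain = simplex 3) (hi : EqOn r.integrand (WordLayer.layerF (WordLayer.toT H) g β₁ γ₁ γ₂ (a + 1)) r.domain) :
    CongInto (layerThree ∪ gzLETwo) (KZ.of r) := by
  rw [WordLayer.toT_gR0Q] at hRint hR
  exact lowerT0Q _ _ g β₁ γ₁ γ₂ a ha hRint hR r hd hi

/-- **D5' step in gap coordinates** (`β₀ ↓`, `α ↑`). -/
theorem lowerB0G (H Qg : MvPolynomial (Fin 4) ℚ) (g β₁ γ₁ γ₂ a : ℕ) (hg : 1 ≤ g)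
    (hRint : IntegrableOn (WordLayer.layerF (WordLayer.toT (WordLayer.gRb0Q H Qg g a)) g β₁ γ₁ γ₂ (a + 1)) (KZ.openOrderedSimplex 3))
    (hR : ∀ s : KZ.IntegralRep 3, s.domain = simplex 3 →
      EqOn s.integrand (WordLayer.layerF (WordLayer.toT (WordLayer.gRb0Q H Qg g a)) g β₁ γ₁ γ₂ (a + 1)) s.domain → CongInto (layerThree ∪ gzLETwo) (KZ.of s))
    (r : KZ.IntegralRep 3) (hd : r.domain = simplex 3) (hi : EqOn r.integrand (WordLayer.layerF (WordLayer.toT H) (g + 1) β₁ γ₁ γ₂ a) r.domain) :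
    CongInto (layerThree ∪ gzLETwo) (KZ.of r) := by
  rw [WordLayer.toT_gRb0Q] at hRint hR
  exact lowerB0Q _ _ g β₁ γ₁ γ₂ a hg hRint hR r hd hi

/-- **D3' step in gap coordinates** (`γ₁ ↓`, `β₁ ↑`). -/
theorem lowerT1dG (H Qg : MvPolynomial (Fin 4) ℚ) (β₀ c b γ₂ α : ℕ) (hb : 1 ≤ b)
    (hRint : IntegrableOn (WordLayer.layerF (WordLayer.toT (WordLayer.gR1dQ H Qg b c)) β₀ (c + 1) b γ₂ α) (KZ.openOrderedSimplex 3))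
    (hR : ∀ s : KZ.IntegralRep 3, s.domain = simplex 3 →
      EqOn s.integrand (WordLayer.layerF (WordLayer.toT (WordLayer.gR1dQ H Qg b c)) β₀ (c + 1) b γ₂ α) s.domain → CongInto (layerThree ∪ gzLETwo) (KZ.of s))
    (r : KZ.IntegralRep 3) (hd : r.domain = simplex 3) (hi : EqOn r.integrand (WordLayer.layerF (WordLayer.toT H) β₀ c (b + 1) γ₂ α) r.domain) :
    CongInto (layerThree ∪ gzLETwo) (KZ.of r) := by
  rw [WordLayer.toT_gR1dQ] at hRint hR
  exact lowerT1dQ _ _ β₀ c b γ₂ α hb hRint hR r hd hi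

/-- β₁-preserving dual t₁-step in gap coordinates. -/
theorem lowerT1d'G (H Qg : MvPolynomial (Fin 4) ℚ) (β₀ c b γ₂ α : ℕ) (hb : 1 ≤ b)
    (hRint : IntegrableOn (WordLayer.layerF (WordLayer.toT (WordLayer.gR1d'Q H Qg b c)) β₀ (c + 1) b γ₂ α) (KZ.openOrderedSimplex 3))
    (hR : ∀ s : KZ.IntegralRep 3, s.domain = simplex 3 →
      EqOn s.integrand (WordLayer.layerF (WordLayer.toT (WordLayer.gR1d'Q H Qg b c)) β₀ (c + 1) b γ₂ α) s.domain → CongInto (layerThree ∪ gzLETwo) (KZ.of s))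
    (r : KZ.IntegralRep 3) (hd : r.domain = simplex 3) (hi : EqOn r.integrand (WordLayer.layerF (WordLayer.toT H) β₀ (c + 1) (b + 1) γ₂ α) r.domain) :
    CongInto (layerThree ∪ gzLETwo) (KZ.of r) := by
  rw [WordLayer.toT_gR1d'Q] at hRint hR
  exact lowerT1d'Q _ _ β₀ c b γ₂ α hb hRint hR r hd hi

end Summit.KontsevichZagierPeriods.KontsevichZagierPeriods.Cruxes.GZNormalFormWThree.GZLadder

/-! # §39  THE SPLIT RULES D1, D2, D7–D9 IN GAP COORDINATES (decomp-kz lens-1 gen 11).  Unit splits keep the numerator; the linear splits consume one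
gap factor of the numerator (`toT (H * X j) = toT H * gap_j`).  Each is `stepA2/A3` with a one-line identity. -/

namespace Summit.KontsevichZagierPeriods.KontsevichZagierPeriods.Cruxes.GZNormalFormWThree.GZLadder

open Set MeasureTheory Literature.NumberTheory.Transcendental
open Summit.KontsevichZagierPeriods.RootDecompZetaThreeFrontier

section SplitRules
open MvPolynomial

/-- Auxiliary step `facts'`. [bookkeeping] -/
private theorem facts' {t : Fin 3 → ℝ} (ht : t ∈ KZ.openOrderedSimplex 3) :
    t 0 ≠ 0 ∧ t 1 ≠ 0 ∧ (1 : ℝ) - t 1 ≠ 0 ∧ (1 : ℝ) - t 2 ≠ 0 ∧ t 0 - t 2 ≠ 0 := WordLayer.simplex3_facts ht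

/-- **D1** (`β₁, γ₁ ≥ 1`): `1 = t₁ + (1-t₁)`, pieces `N/den(B - e_{β₁})`, `N/den(B - e_{γ₁})`. -/
theorem splitD1 (N : MvPolynomial (Fin 3) ℚ) (b0 b c c2 al : ℕ)
    (h₁int : IntegrableOn (WordLayer.layerF N b0 b (c + 1) c2 al) (KZ.openOrderedSimplex 3))
    (h₁ : ∀ s : KZ.IntegralRep 3, s.domain = simplex 3 → EqOn s.integrand (WordLayer.layerF N b0 b (c + 1) c2 al) s.domain →
      CongInto (layerThree ∪ gzLETwo) (KZ.of s))
    (h₂int : IntegrableOn (WordLayer.layerF N b0 (b + 1) c c2 al) (KZ.openOrderedSimplex 3))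
    (h₂ : ∀ s : KZ.IntegralRep 3, s.domain = simplex 3 → EqOn s.integrand (WordLayer.layerF N b0 (b + 1) c c2 al) s.domain →
      CongInto (layerThree ∪ gzLETwo) (KZ.of s))
    (r : KZ.IntegralRep 3) (hd : r.domain = simplex 3) (hi : EqOn r.integrand (WordLayer.layerF N b0 (b + 1) (c + 1) c2 al) r.domain) :
    CongInto (layerThree ∪ gzLETwo) (KZ.of r) :=
  stepA2 N N N b0 (b + 1) (c + 1) c2 al b0 b (c + 1) c2 al b0 (b + 1) c c2 al (fun t ht => by
    obtain ⟨h0, h1, h1', h2', hδ⟩ := facts' ht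
    simp only [WordLayer.layerF]
    field_simp
    ring) h₁int h₁ h₂int h₂ r hd hi

/-- **D2** (`β₀, γ₂, α ≥ 1`): `1 = (1-t₂) + t₀ - (t₀-t₂)`, pieces `N/den(B-e_{γ₂})`, `N/den(B-e_{β₀})`, `(-N)/den(B-e_α)`. -/
theorem splitD2 (N : MvPolynomial (Fin 3) ℚ) (g b1 c1 h a : ℕ)
    (h₁int : IntegrableOn (WordLayer.layerF N (g + 1) b1 c1 h (a + 1)) (KZ.openOrderedSimplex 3))
    (h₁ : ∀ s : KZ.IntegralRep 3, s.domain = simplex 3 → EqOn s.integrand (WordLayer.layerF N (g + 1) b1 c1 h (a + 1)) s.domain →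
      CongInto (layerThree ∪ gzLETwo) (KZ.of s))
    (h₂int : IntegrableOn (WordLayer.layerF N g b1 c1 (h + 1) (a + 1)) (KZ.openOrderedSimplex 3))
    (h₂ : ∀ s : KZ.IntegralRep 3, s.domain = simplex 3 → EqOn s.integrand (WordLayer.layerF N g b1 c1 (h + 1) (a + 1)) s.domain →
      CongInto (layerThree ∪ gzLETwo) (KZ.of s))
    (h₃int : IntegrableOn (WordLayer.layerF (-N) (g + 1) b1 c1 (h + 1) a) (KZ.openOrderedSimplex 3))
    (h₃ : ∀ s : KZ.IntegralRep 3, s.domain = simplex 3 → EqOn s.integrand (WordLayer.layerF (-N) (g + 1) b1 c1 (h + 1) a) s.domain →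
      CongInto (layerThree ∪ gzLETwo) (KZ.of s))
    (r : KZ.IntegralRep 3) (hd : r.domain = simplex 3) (hi : EqOn r.integrand (WordLayer.layerF N (g + 1) b1 c1 (h + 1) (a + 1)) r.domain) :
    CongInto (layerThree ∪ gzLETwo) (KZ.of r) :=
  stepA3 N N N (-N) (g + 1) b1 c1 (h + 1) (a + 1) (g + 1) b1 c1 h (a + 1) g b1 c1 (h + 1) (a + 1) (g + 1) b1 c1 (h + 1) a (fun t ht => by
    obtain ⟨h0, h1, h1', h2', hδ⟩ := facts' ht
    simp only [WordLayer.layerF, map_neg]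
    field_simp
    ring) h₁int h₁ h₂int h₂ h₃int h₃ r hd hi

/-- **D7** (`κ₃ ≥ 1`, `β₀, α ≥ 1`): `t₂ = t₀ - (t₀-t₂)`; numerator `toT (H·X₃) = toT H · t₂`. -/
theorem splitD7 (H : MvPolynomial (Fin 4) ℚ) (g b1 c1 c2 a : ℕ)
    (h₁int : IntegrableOn (WordLayer.layerF (WordLayer.toT H) g b1 c1 c2 (a + 1)) (KZ.openOrderedSimplex 3))
    (h₁ : ∀ s : KZ.IntegralRep 3, s.domain = simplex 3 → EqOn s.integrand (WordLayer.layerF (WordLayer.toT H) g b1 c1 c2 (a + 1)) s.domain →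
      CongInto (layerThree ∪ gzLETwo) (KZ.of s))
    (h₂int : IntegrableOn (WordLayer.layerF (WordLayer.toT (-H)) (g + 1) b1 c1 c2 a) (KZ.openOrderedSimplex 3))
    (h₂ : ∀ s : KZ.IntegralRep 3, s.domain = simplex 3 → EqOn s.integrand (WordLayer.layerF (WordLayer.toT (-H)) (g + 1) b1 c1 c2 a) s.domain →
      CongInto (layerThree ∪ gzLETwo) (KZ.of s))
    (r : KZ.IntegralRep 3) (hd : r.domain = simplex 3)
    (hi : EqOn r.integrand (WordLayer.layerF (WordLayer.toT (H * X 3)) (g + 1) b1 c1 c2 (a + 1)) r.domain) :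
    CongInto (layerThree ∪ gzLETwo) (KZ.of r) :=
  stepA2 _ _ _ (g + 1) b1 c1 c2 (a + 1) g b1 c1 c2 (a + 1) (g + 1) b1 c1 c2 a (fun t ht => by
    obtain ⟨h0, h1, h1', h2', hδ⟩ := facts' ht
    simp only [WordLayer.layerF, map_mul, map_neg, WordLayer.toT_X, WordLayer.gvec_three, MvPolynomial.aeval_X]
    field_simp
    ring) h₁int h₁ h₂int h₂ r hd hi

/-- **D7'** (`κ₀ ≥ 1`, `γ₂, α ≥ 1`): `1-t₀ = (1-t₂) - (t₀-t₂)`; numerator `toT (H·X₀)`. -/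
theorem splitD7' (H : MvPolynomial (Fin 4) ℚ) (b0 b1 c1 h a : ℕ)
    (h₁int : IntegrableOn (WordLayer.layerF (WordLayer.toT H) b0 b1 c1 h (a + 1)) (KZ.openOrderedSimplex 3))
    (h₁ : ∀ s : KZ.IntegralRep 3, s.domain = simplex 3 → EqOn s.integrand (WordLayer.layerF (WordLayer.toT H) b0 b1 c1 h (a + 1)) s.domain →
      CongInto (layerThree ∪ gzLETwo) (KZ.of s))
    (h₂int : IntegrableOn (WordLayer.layerF (WordLayer.toT (-H)) b0 b1 c1 (h + 1) a) (KZ.openOrderedSimplex 3))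
    (h₂ : ∀ s : KZ.IntegralRep 3, s.domain = simplex 3 → EqOn s.integrand (WordLayer.layerF (WordLayer.toT (-H)) b0 b1 c1 (h + 1) a) s.domain →
      CongInto (layerThree ∪ gzLETwo) (KZ.of s))
    (r : KZ.IntegralRep 3) (hd : r.domain = simplex 3)
    (hi : EqOn r.integrand (WordLayer.layerF (WordLayer.toT (H * X 0)) b0 b1 c1 (h + 1) (a + 1)) r.domain) :
    CongInto (layerThree ∪ gzLETwo) (KZ.of r) :=
  stepA2 _ _ _ b0 b1 c1 (h + 1) (a + 1) b0 b1 c1 h (a + 1) b0 b1 c1 (h + 1) a (fun t ht => by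
    obtain ⟨h0, h1, h1', h2', hδ⟩ := facts' ht
    simp only [WordLayer.layerF, map_mul, map_neg, map_sub, map_one, WordLayer.toT_X, WordLayer.gvec_zero, MvPolynomial.aeval_X]
    field_simp
    ring) h₁int h₁ h₂int h₂ r hd hi

/-- **D8** (`κ₂ ≥ 1`, `γ₁, γ₂ ≥ 1`): `t₁-t₂ = (1-t₂) - (1-t₁)`; numerator `toT (H·X₂)`. -/
theorem splitD8 (H : MvPolynomial (Fin 4) ℚ) (b0 b1 c h al : ℕ)
    (h₁int : IntegrableOn (WordLayer.layerF (WordLayer.toT H) b0 b1 (c + 1) h al) (KZ.openOrderedSimplex 3))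
    (h₁ : ∀ s : KZ.IntegralRep 3, s.domain = simplex 3 → EqOn s.integrand (WordLayer.layerF (WordLayer.toT H) b0 b1 (c + 1) h al) s.domain →
      CongInto (layerThree ∪ gzLETwo) (KZ.of s))
    (h₂int : IntegrableOn (WordLayer.layerF (WordLayer.toT (-H)) b0 b1 c (h + 1) al) (KZ.openOrderedSimplex 3))
    (h₂ : ∀ s : KZ.IntegralRep 3, s.domain = simplex 3 → EqOn s.integrand (WordLayer.layerF (WordLayer.toT (-H)) b0 b1 c (h + 1) al) s.domain →
      CongInto (layerThree ∪ gzLETwo) (KZ.of s))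
    (r : KZ.IntegralRep 3) (hd : r.domain = simplex 3)
    (hi : EqOn r.integrand (WordLayer.layerF (WordLayer.toT (H * X 2)) b0 b1 (c + 1) (h + 1) al) r.domain) :
    CongInto (layerThree ∪ gzLETwo) (KZ.of r) :=
  stepA2 _ _ _ b0 b1 (c + 1) (h + 1) al b0 b1 (c + 1) h al b0 b1 c (h + 1) al (fun t ht => by
    obtain ⟨h0, h1, h1', h2', hδ⟩ := facts' ht
    simp only [WordLayer.layerF, map_mul, map_neg, map_sub, WordLayer.toT_X, WordLayer.gvec_two, MvPolynomial.aeval_X]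
    field_simp
    ring) h₁int h₁ h₂int h₂ r hd hi

/-- **D8'** (`κ₁ ≥ 1`, `β₀, β₁ ≥ 1`): `t₀-t₁ = t₀ - t₁`; numerator `toT (H·X₁)`. -/
theorem splitD8' (H : MvPolynomial (Fin 4) ℚ) (g b c1 c2 al : ℕ)
    (h₁int : IntegrableOn (WordLayer.layerF (WordLayer.toT H) g (b + 1) c1 c2 al) (KZ.openOrderedSimplex 3))
    (h₁ : ∀ s : KZ.IntegralRep 3, s.domain = simplex 3 → EqOn s.integrand (WordLayer.layerF (WordLayer.toT H) g (b + 1) c1 c2 al) s.domain →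
      CongInto (layerThree ∪ gzLETwo) (KZ.of s))
    (h₂int : IntegrableOn (WordLayer.layerF (WordLayer.toT (-H)) (g + 1) b c1 c2 al) (KZ.openOrderedSimplex 3))
    (h₂ : ∀ s : KZ.IntegralRep 3, s.domain = simplex 3 → EqOn s.integrand (WordLayer.layerF (WordLayer.toT (-H)) (g + 1) b c1 c2 al) s.domain →
      CongInto (layerThree ∪ gzLETwo) (KZ.of s))
    (r : KZ.IntegralRep 3) (hd : r.domain = simplex 3)
    (hi : EqOn r.integrand (WordLayer.layerF (WordLayer.toT (H * X 1)) (g + 1) (b + 1) c1 c2 al) r.domain) :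
    CongInto (layerThree ∪ gzLETwo) (KZ.of r) :=
  stepA2 _ _ _ (g + 1) (b + 1) c1 c2 al g (b + 1) c1 c2 al (g + 1) b c1 c2 al (fun t ht => by
    obtain ⟨h0, h1, h1', h2', hδ⟩ := facts' ht
    simp only [WordLayer.layerF, map_mul, map_neg, map_sub, WordLayer.toT_X, WordLayer.gvec_one, MvPolynomial.aeval_X]
    field_simp
    ring) h₁int h₁ h₂int h₂ r hd hi

/-- **D9** (`κ₂ ≥ 1`, `β₀, β₁, α ≥ 1`): `t₁-t₂ = t₁ - t₀ + (t₀-t₂)`; numerator `toT (H·X₂)`. -/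
theorem splitD9 (H : MvPolynomial (Fin 4) ℚ) (g b c1 c2 a : ℕ)
    (h₁int : IntegrableOn (WordLayer.layerF (WordLayer.toT H) (g + 1) b c1 c2 (a + 1)) (KZ.openOrderedSimplex 3))
    (h₁ : ∀ s : KZ.IntegralRep 3, s.domain = simplex 3 → EqOn s.integrand (WordLayer.layerF (WordLayer.toT H) (g + 1) b c1 c2 (a + 1)) s.domain →
      CongInto (layerThree ∪ gzLETwo) (KZ.of s))
    (h₂int : IntegrableOn (WordLayer.layerF (WordLayer.toT (-H)) g (b + 1) c1 c2 (a + 1)) (KZ.openOrderedSimplex 3))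
    (h₂ : ∀ s : KZ.IntegralRep 3, s.domain = simplex 3 → EqOn s.integrand (WordLayer.layerF (WordLayer.toT (-H)) g (b + 1) c1 c2 (a + 1)) s.domain →
      CongInto (layerThree ∪ gzLETwo) (KZ.of s))
    (h₃int : IntegrableOn (WordLayer.layerF (WordLayer.toT H) (g + 1) (b + 1) c1 c2 a) (KZ.openOrderedSimplex 3))
    (h₃ : ∀ s : KZ.IntegralRep 3, s.domain = simplex 3 → EqOn s.integrand (WordLayer.layerF (WordLayer.toT H) (g + 1) (b + 1) c1 c2 a) s.domain →
      CongInto (layerThree ∪ gzLETwo) (KZ.of s))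
    (r : KZ.IntegralRep 3) (hd : r.domain = simplex 3)
    (hi : EqOn r.integrand (WordLayer.layerF (WordLayer.toT (H * X 2)) (g + 1) (b + 1) c1 c2 (a + 1)) r.domain) :
    CongInto (layerThree ∪ gzLETwo) (KZ.of r) :=
  stepA3 _ _ _ _ (g + 1) (b + 1) c1 c2 (a + 1) (g + 1) b c1 c2 (a + 1) g (b + 1) c1 c2 (a + 1) (g + 1) (b + 1) c1 c2 a (fun t ht => by
    obtain ⟨h0, h1, h1', h2', hδ⟩ := facts' ht
    simp only [WordLayer.layerF, map_mul, map_neg, map_sub, WordLayer.toT_X, WordLayer.gvec_two, MvPolynomial.aeval_X]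
    field_simp
    ring) h₁int h₁ h₂int h₂ h₃int h₃ r hd hi

/-- **D9'** (`κ₁ ≥ 1`, `γ₁, γ₂, α ≥ 1`): `t₀-t₁ = (1-t₁) - (1-t₂) + (t₀-t₂)`; numerator `toT (H·X₁)`. -/
theorem splitD9' (H : MvPolynomial (Fin 4) ℚ) (b0 b1 c h a : ℕ)
    (h₁int : IntegrableOn (WordLayer.layerF (WordLayer.toT H) b0 b1 c (h + 1) (a + 1)) (KZ.openOrderedSimplex 3))
    (h₁ : ∀ s : KZ.IntegralRep 3, s.domain = simplex 3 → EqOn s.integrand (WordLayer.layerF (WordLayer.toT H) b0 b1 c (h + 1) (a + 1)) s.domain →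
      CongInto (layerThree ∪ gzLETwo) (KZ.of s))
    (h₂int : IntegrableOn (WordLayer.layerF (WordLayer.toT (-H)) b0 b1 (c + 1) h (a + 1)) (KZ.openOrderedSimplex 3))
    (h₂ : ∀ s : KZ.IntegralRep 3, s.domain = simplex 3 → EqOn s.integrand (WordLayer.layerF (WordLayer.toT (-H)) b0 b1 (c + 1) h (a + 1)) s.domain →
      CongInto (layerThree ∪ gzLETwo) (KZ.of s))
    (h₃int : IntegrableOn (WordLayer.layerF (WordLayer.toT H) b0 b1 (c + 1) (h + 1) a) (KZ.openOrderedSimplex 3))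
    (h₃ : ∀ s : KZ.IntegralRep 3, s.domain = simplex 3 → EqOn s.integrand (WordLayer.layerF (WordLayer.toT H) b0 b1 (c + 1) (h + 1) a) s.domain →
      CongInto (layerThree ∪ gzLETwo) (KZ.of s))
    (r : KZ.IntegralRep 3) (hd : r.domain = simplex 3)
    (hi : EqOn r.integrand (WordLayer.layerF (WordLayer.toT (H * X 1)) b0 b1 (c + 1) (h + 1) (a + 1)) r.domain) :
    CongInto (layerThree ∪ gzLETwo) (KZ.of r) :=
  stepA3 _ _ _ _ b0 b1 (c + 1) (h + 1) (a + 1) b0 b1 c (h + 1) (a + 1) b0 b1 (c + 1) h (a + 1) b0 b1 (c + 1) (h + 1) a (fun t ht => by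
    obtain ⟨h0, h1, h1', h2', hδ⟩ := facts' ht
    simp only [WordLayer.layerF, map_mul, map_neg, map_sub, WordLayer.toT_X, WordLayer.gvec_one, MvPolynomial.aeval_X]
    field_simp
    ring) h₁int h₁ h₂int h₂ h₃int h₃ r hd hi

end SplitRules

end Summit.KontsevichZagierPeriods.KontsevichZagierPeriods.Cruxes.GZNormalFormWThree.GZLadder

/-! # §40  UNIFORM EVALUATION ON THE OPEN SIMPLEX (decomp-kz lens-1 gen 11): on `Δ₃°` all four gaps are non-zero, so derivatives of gap monomials with
SYMBOLIC exponents evaluate in *divided form* `∂ᵢ g^s ↦ sᵢ · g^s / gᵢ` (no truncated subtraction, no case split), shifts `g^{s+eᵢ} = g^s·gᵢ`,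
and the D6 remainder of the short-Q law (NODE.md ADDENDUM 10) in closed form: `a · R'_{D6} = g^κ · (1-t₂) · (κ₂/g₂ - κ₃/g₃)`. -/

namespace Summit.KontsevichZagierPeriods.RootDecompZetaThreeFrontier.WordLayer

open Set MeasureTheory Literature.NumberTheory.Transcendental MvPolynomial
open Summit.KontsevichZagierPeriods.KontsevichZagierPeriods.Theorems.RootDecompZetaThreeFrontierWordMoves (mem_simplex_three_iff)

section UniformEval

/-- the gap monomial `g^s (t) = (1-t₀)^{s₀} (t₀-t₁)^{s₁} (t₁-t₂)^{s₂} t₂^{s₃}` -/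
def gmon (s : Fin 4 → ℕ) (t : Fin 3 → ℝ) : ℝ := (1 - t 0) ^ s 0 * (t 0 - t 1) ^ s 1 * (t 1 - t 2) ^ s 2 * t 2 ^ s 3

/-- Auxiliary step `gmon_eq_prod`. [bookkeeping] -/
theorem gmon_eq_prod (s : Fin 4 → ℕ) (t : Fin 3 → ℝ) : gmon s t = ∏ i, gaps t i ^ s i := by
  simp [gmon, Fin.prod_univ_four]

/-- Auxiliary step `gapF_eq_gmon_div`. [bookkeeping] -/
theorem gapF_eq_gmon_div (κ : Fin 4 → ℕ) (β₀ β₁ γ₁ γ₂ α : ℕ) (t : Fin 3 → ℝ) :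
    gapF κ β₀ β₁ γ₁ γ₂ α t = gmon κ t / (t 0 ^ β₀ * t 1 ^ β₁ * (1 - t 1) ^ γ₁ * (1 - t 2) ^ γ₂ * (t 0 - t 2) ^ α) := rfl

/-- Auxiliary step `aeval_gaps_monomial`. [bookkeeping] -/
theorem aeval_gaps_monomial (s : Fin 4 →₀ ℕ) (c : ℚ) (t : Fin 3 → ℝ) :
    aeval (gaps t) (monomial s c) = (c : ℝ) * gmon s t := by
  simp only [aeval_monomial, gmon_eq_prod, eq_ratCast, Finsupp.prod_pow]

/-- Auxiliary step `gaps_ne_zero`. [bookkeeping] -/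
theorem gaps_ne_zero {t : Fin 3 → ℝ} (ht : t ∈ KZ.openOrderedSimplex 3) (i : Fin 4) : gaps t i ≠ 0 := by
  obtain ⟨h2, h21, h10, h0⟩ := (mem_simplex_three_iff t).1 ht
  fin_cases i <;> simp <;> linarith

/-- Auxiliary step `gmon_ne_zero`. [bookkeeping] -/
theorem gmon_ne_zero {t : Fin 3 → ℝ} (ht : t ∈ KZ.openOrderedSimplex 3) (s : Fin 4 → ℕ) : gmon s t ≠ 0 := by
  rw [gmon_eq_prod]
  exact Finset.prod_ne_zero_iff.2 fun i _ => pow_ne_zero _ (gaps_ne_zero ht i)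

/-- shift up: `g^{s+eᵢ} = g^s · gᵢ` -/
theorem gmon_add_single (s : Fin 4 →₀ ℕ) (i : Fin 4) (t : Fin 3 → ℝ) :
    gmon ((s + Finsupp.single i 1 : Fin 4 →₀ ℕ) : Fin 4 → ℕ) t = gmon s t * gaps t i := by
  fin_cases i <;> simp [gmon, Finsupp.add_apply, pow_succ] <;> ring

/-- shift down (divided form, valid for every exponent): `sᵢ · g^{s-eᵢ} = sᵢ · g^s / gᵢ` on `Δ₃°` -/
theorem natCast_mul_gmon_sub_single {t : Fin 3 → ℝ} (ht : t ∈ KZ.openOrderedSimplex 3) (s : Fin 4 →₀ ℕ) (i : Fin 4) :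
    (s i : ℝ) * gmon ((s - Finsupp.single i 1 : Fin 4 →₀ ℕ) : Fin 4 → ℕ) t = (s i : ℝ) * gmon s t / gaps t i := by
  rcases Nat.eq_zero_or_pos (s i) with h0 | hpos
  · simp [h0]
  · have hs : s = (s - Finsupp.single i 1) + Finsupp.single i 1 := by
      ext j
      by_cases hj : j = i
      · subst hj; simp; omega
      · simp [hj]
    have key : gmon s t = gmon ((s - Finsupp.single i 1 : Fin 4 →₀ ℕ) : Fin 4 → ℕ) t * gaps t i := by
      conv_lhs => rw [hs]
      exact gmon_add_single _ _ _
    rw [key, mul_div_assoc, mul_div_cancel_right₀ _ (gaps_ne_zero ht i)]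

/-- **uniform derivative evaluation**: `aeval g (∂ᵢ (c·g^s)) = c · sᵢ · g^s / gᵢ` on `Δ₃°` -/
theorem aeval_gaps_pderiv_monomial {t : Fin 3 → ℝ} (ht : t ∈ KZ.openOrderedSimplex 3) (i : Fin 4) (s : Fin 4 →₀ ℕ) (c : ℚ) :
    aeval (gaps t) (pderiv i (monomial s c)) = (c : ℝ) * (s i : ℝ) * gmon s t / gaps t i := by
  rw [pderiv_monomial, aeval_gaps_monomial, Rat.cast_mul, Rat.cast_natCast, mul_assoc, natCast_mul_gmon_sub_single ht]
  ring

/-- `aeval g (gD d (c·g^s)) = c · g^s · (s_{d+1}/g_{d+1} - s_d/g_d)` on `Δ₃°` -/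
theorem aeval_gaps_gD_monomial {t : Fin 3 → ℝ} (ht : t ∈ KZ.openOrderedSimplex 3) (d : Fin 3) (s : Fin 4 →₀ ℕ) (c : ℚ) :
    aeval (gaps t) (gD d (monomial s c)) =
      (c : ℝ) * gmon s t * ((s d.succ : ℝ) / gaps t d.succ - (s d.castSucc : ℝ) / gaps t d.castSucc) := by
  rw [gD, map_sub, aeval_gaps_pderiv_monomial ht, aeval_gaps_pderiv_monomial ht]
  ring

/-- the class of a gap-world numerator, evaluated: `layerF (toT H) B t = aeval g H / den_B` -/
theorem layerF_toT_eq (H : MvPolynomial (Fin 4) ℚ) (β₀ β₁ γ₁ γ₂ α : ℕ) (t : Fin 3 → ℝ) :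
    layerF (toT H) β₀ β₁ γ₁ γ₂ α t = aeval (gaps t) H / (t 0 ^ β₀ * t 1 ^ β₁ * (1 - t 1) ^ γ₁ * (1 - t 2) ^ γ₂ * (t 0 - t 2) ^ α) := by
  rw [layerF, aeval_toT]

/-- **D6 remainder in closed form** (short-Q law, `Q = 0`): on `Δ₃°`,
`layerF (toT (gR2Q (c·g^κ) 0 0 a)) β₀ β₁ γ₁ 1 a t = -(1/a) · c · g^κ · (κ₃/t₂ - κ₂/(t₁-t₂)) · (1-t₂) / den_{(β₀,β₁,γ₁,1,a)}`. -/
theorem layerF_toT_gR2Q_monomial_zero {t : Fin 3 → ℝ} (ht : t ∈ KZ.openOrderedSimplex 3) (κ : Fin 4 →₀ ℕ) (c : ℚ) (a β₀ β₁ γ₁ : ℕ) :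
    layerF (toT (gR2Q (monomial κ c) 0 0 a)) β₀ β₁ γ₁ 1 a t =
      -(1 / (a : ℝ)) * ((c : ℝ) * gmon κ t * (((κ 3 : ℕ) : ℝ) / t 2 - ((κ 2 : ℕ) : ℝ) / (t 1 - t 2)) * (1 - t 2)) /
        (t 0 ^ β₀ * t 1 ^ β₁ * (1 - t 1) ^ γ₁ * (1 - t 2) ^ 1 * (t 0 - t 2) ^ a) := by
  rw [layerF_toT_eq, gR2Q]
  have h3 : ((2 : Fin 3).succ : Fin 4) = 3 := rfl
  have h2 : ((2 : Fin 3).castSucc : Fin 4) = 2 := rfl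
  simp only [map_sub, map_neg, map_mul, map_add, map_zero, mul_zero, zero_mul, add_zero, gD_zero, MvPolynomial.aeval_C, map_natCast,
    aeval_gaps_gD_monomial ht, fC2, fAl, MvPolynomial.aeval_X, gaps_zero, gaps_one, gaps_two, Nat.cast_zero, eq_ratCast,
    one_div, Rat.cast_inv, Rat.cast_natCast, h3, h2, gaps_three]
  ring

end UniformEval

end Summit.KontsevichZagierPeriods.RootDecompZetaThreeFrontier.WordLayer

/-! # §41  RULE D6 OF THE SHORT-Q LAW AS SIX GAP CLASSES (decomp-kz lens-1 gen 11): the uniform shift lemma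
`κⱼ · g^{κ+eᵢ-eⱼ} = κⱼ · g^κ · gᵢ/gⱼ` (truncated subtraction is harmless: the factor `κⱼ` kills the junk case) and the D6 remainder as the
signed sum of the six scaled gap classes `(qκ₂/a)·{κ, κ+e₁-e₂, κ+e₀-e₂}`, `-(qκ₃/a)·{κ+e₂-e₃, κ+e₁-e₃, κ+e₀-e₃}` over `B' = (β₀,β₁,γ₁,1,a)`. -/

namespace Summit.KontsevichZagierPeriods.RootDecompZetaThreeFrontier.WordLayer

open Set MeasureTheory Literature.NumberTheory.Transcendental MvPolynomial
open Summit.KontsevichZagierPeriods.KontsevichZagierPeriods.Theorems.RootDecompZetaThreeFrontierWordMoves (mem_simplex_three_iff)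

section RuleD6

/-- gap-exponent shift `κ + eᵢ - eⱼ` (a `Finsupp`, truncated subtraction) -/
noncomputable def gshift (κ : Fin 4 →₀ ℕ) (i j : Fin 4) : Fin 4 →₀ ℕ := κ + Finsupp.single i 1 - Finsupp.single j 1

/-- **uniform shift**: `κⱼ · g^{κ+eᵢ-eⱼ} = κⱼ · g^κ · gᵢ / gⱼ` on `Δ₃°` (`i ≠ j`) -/
theorem natCast_mul_gmon_gshift {t : Fin 3 → ℝ} (ht : t ∈ KZ.openOrderedSimplex 3) (κ : Fin 4 →₀ ℕ) (i j : Fin 4) (hij : i ≠ j) :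
    (κ j : ℝ) * gmon (gshift κ i j) t = (κ j : ℝ) * gmon κ t * gaps t i / gaps t j := by
  have h1 : ((κ + Finsupp.single i 1 : Fin 4 →₀ ℕ) j : ℕ) = κ j := by simp [hij]
  have := natCast_mul_gmon_sub_single ht (κ + Finsupp.single i 1) j
  rw [h1, gmon_add_single] at this
  rw [gshift, this, mul_assoc]

end RuleD6
end Summit.KontsevichZagierPeriods.RootDecompZetaThreeFrontier.WordLayer
end
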